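import Mathlib.Analysis.Calculus.MeanValue
import Mathlib.Analysis.Calculus.UniformLimitsDeriv
import Literature.Analysis.FunctionSpaces.HolderSpace
import HarnessLib

/-!
# The Banach space `C^{1,r}_*(E, F)` of `C¹` maps with bounded Hölder-continuous derivative

Topic `Literature/Analysis/FunctionSpaces`. The space
`B = {X : E → F | |X|_{1,γ} < ∞}`, `|X|_{1,γ} = |X(0)| + |∇X|₀ + |∇X|_γ`, of Majda–Bertozzi,
*Vorticity and Incompressible Flow* (CUP 2002), §4.1.1, eqs. (4.12)–(4.14) (p. 126 of the held
text): `C¹` maps whose derivative is bounded and `γ`-Hölder, normed by the value at the origin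
plus the inhomogeneous Hölder norm of the derivative. The maps themselves may be unbounded
("The term `|X(0)| < ∞` in the norm allows `X` to be unbounded as `|α| ↗ ∞`", loc. cit.): the
particle-trajectory maps `X(·, t) ≈ id` of the Lagrangian formulation of the Euler equations live
here, and the local existence theorem (Thm 4.2) is the Picard theorem on this Banach space. This
file is infrastructure for discharging `Literature.Analysis.FluidPDE.MajdaBertozzi2002_holderEulerBKM`
(`ElgindiBlowupContinuation.lean`) through its Lagrangian proof.

## Contents (all proved)

* `C1HolderMap E F r` — the bundled type (fields: the map, `ContDiff ℝ 1`, and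
  `MemBoundedHolder r (fderiv ℝ ·)` of `HolderNorm.lean`), with `FunLike`, the real vector space
  structure (pointwise), and `fderivBHF : C1HolderMap E F r → BoundedHolderFunction E (E →L[ℝ] F) r`
  (the derivative as an element of the Banach space `C^{0,r}_b` of `HolderSpace.lean`);
* the norm `‖X‖ = ‖X 0‖ + ‖fderivBHF X‖ = |X(0)| + |∇X|₀ + [∇X]_r` ((4.13)), making
  `C1HolderMap E F r` a real normed space (`instNormedAddCommGroup`, `instNormedSpace`;
  definiteness: a map with zero derivative vanishing at `0` is zero, Mathlib
  `is_const_of_fderiv_eq_zero`);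
* the basic estimates `norm_apply_zero_le`, `norm_fderiv_le`, `norm_sub_apply_le`
  (`‖X x − X y‖ ≤ ‖X‖ ‖x − y‖`, mean value inequality) and `norm_apply_le`
  (`‖X x‖ ≤ ‖X‖ (1 + ‖x‖)`), the continuous linear maps `fderivCLM` and `evalCLM x`;
* **completeness** (`instCompleteSpace`, Majda–Bertozzi p. 126: "The space `B` … is a Banach
  space; it is linear, normed, and complete"): a Cauchy sequence has Cauchy derivatives in
  `C^{0,r}_b` (complete: `BoundedHolderFunction.completeSpace_holds`) and Cauchy values at every
  point; the pointwise limit has the limit derivative by Mathlib's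
  `hasFDerivAt_of_tendstoUniformly`.

## Design notes

* Generality: `E`, `F` real normed spaces (`F` complete for completeness); `E = F = ℝ³`,
  `r = γ ∈ (0, 1)` in Majda–Bertozzi. No condition on `r` is needed here.
* The norm is anchored at `0 : E` as printed; any other base point gives an equivalent norm
  (`norm_apply_le`).
* Mathlib has `ContDiff`, `fderiv`, Hölder seminorms and `X →ᵇ Y`, but no bundled `C^{1,α}`-type
  space (searched `Holder`, `ContDiffBump`, `ContDiffMap`: the tree's `ContDiffMapSupportedIn`
  is the test-function space). The predicate `MemContDiffHolder 1 r` of `HolderNorm.lean`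
  (bounded `f` as well) is the bounded subclass; `MemContDiffHolder.toC1HolderMap` embeds it.

## References

* A. J. Majda, A. L. Bertozzi, *Vorticity and Incompressible Flow* (CUP 2002), §4.1.1,
  (4.12)–(4.15), p. 126. [MajdaBertozziCUP2002]
* D. Gilbarg, N. Trudinger, *Elliptic PDE of Second Order* (2001), §4.1 (Hölder spaces).
-/

noncomputable section

open Set Filter Topology BoundedContinuousFunction

open scoped NNReal ENNReal

namespace Literature.Analysis.FunctionSpaces

/-- **Majda–Bertozzi's space `B`** ((4.12), p. 126): `C¹` maps `X : E → F` whose derivative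
`∇X = fderiv ℝ X` is bounded and `r`-Hölder (`MemBoundedHolder r`), to be normed by
`|X|_{1,r} = ‖X 0‖ + ‖∇X‖_∞ + [∇X]_r` ((4.13)). The map itself may be unbounded. [cite: MajdaBertozziCUP2002, §4.1.1 (4.12)–(4.13) (p. 126)] -/
structure C1HolderMap (E F : Type*) [NormedAddCommGroup E] [NormedSpace ℝ E]
    [NormedAddCommGroup F] [NormedSpace ℝ F] (r : ℝ≥0) where
  /-- The underlying map. -/
  toFun : E → F
  /-- The map is continuously differentiable. -/
  contDiff' : ContDiff ℝ 1 toFun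
  /-- The derivative is bounded and `r`-Hölder. -/
  memBoundedHolder' : MemBoundedHolder r (fderiv ℝ toFun)

namespace C1HolderMap

variable {E F : Type*} [NormedAddCommGroup E] [NormedSpace ℝ E] [NormedAddCommGroup F]
  [NormedSpace ℝ F] {r : ℝ≥0}

/-- `C1HolderMap E F r` is a type of functions `E → F`. [folklore] -/
instance instFunLike : FunLike (C1HolderMap E F r) E F where
  coe := toFun
  coe_injective f g h := by cases f; cases g; congr

/-- Extensionality. [folklore] -/
@[ext]
theorem ext {f g : C1HolderMap E F r} (h : ∀ x, f x = g x) : f = g :=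
  DFunLike.ext f g h

/-- The coercion of the constructor. [folklore] -/
@[simp]
theorem coe_mk (f : E → F) (h1 : ContDiff ℝ 1 f) (h2 : MemBoundedHolder r (fderiv ℝ f)) :
    ((⟨f, h1, h2⟩ : C1HolderMap E F r) : E → F) = f := rfl

/-- Elements are `C¹`. [folklore] -/
theorem contDiff (f : C1HolderMap E F r) : ContDiff ℝ 1 (f : E → F) := f.contDiff'

/-- Elements are differentiable. [folklore] -/
theorem differentiable (f : C1HolderMap E F r) : Differentiable ℝ (f : E → F) :=
  f.contDiff.differentiable one_ne_zero

/-- Elements are continuous. [folklore] -/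
theorem continuous (f : C1HolderMap E F r) : Continuous (f : E → F) :=
  f.contDiff.continuous

/-- The derivative of an element is continuous. [folklore] -/
theorem continuous_fderiv (f : C1HolderMap E F r) : Continuous (fderiv ℝ (f : E → F)) :=
  f.contDiff.continuous_fderiv one_ne_zero

/-- The derivative of an element is bounded and `r`-Hölder. [folklore] -/
theorem memBoundedHolder (f : C1HolderMap E F r) : MemBoundedHolder r (fderiv ℝ (f : E → F)) :=
  f.memBoundedHolder'

/-- **The derivative as an element of `C^{0,r}_b(E, E →L[ℝ] F)`** (the components `|∇X|₀ + |∇X|_r`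
of the norm (4.13)). [folklore] -/
def fderivBHF (f : C1HolderMap E F r) : BoundedHolderFunction E (E →L[ℝ] F) r :=
  BoundedHolderFunction.ofMemBoundedHolder (fderiv ℝ (f : E → F)) f.memBoundedHolder
    f.continuous_fderiv

/-- The underlying function of `fderivBHF f` is `fderiv ℝ f`. [folklore] -/
@[simp]
theorem coe_fderivBHF (f : C1HolderMap E F r) :
    (f.fderivBHF : E → E →L[ℝ] F) = fderiv ℝ (f : E → F) := rfl

/-- Pointwise: `fderivBHF f x = fderiv ℝ f x`. [folklore] -/
@[simp]
theorem fderivBHF_apply (f : C1HolderMap E F r) (x : E) : f.fderivBHF x = fderiv ℝ (f : E → F) x :=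
  rfl

/-! ### Algebraic structure (pointwise) -/

/-- The zero map. [folklore] -/
instance instZero : Zero (C1HolderMap E F r) :=
  ⟨⟨0, contDiff_const, by
    have h : fderiv ℝ (0 : E → F) = 0 := by
      funext x
      exact fderiv_const_apply 0
    rw [h]
    exact memBoundedHolder_zero⟩⟩

/-- Pointwise addition. [folklore] -/
instance instAdd : Add (C1HolderMap E F r) :=
  ⟨fun f g => ⟨⇑f + ⇑g, f.contDiff.add g.contDiff, by
    have h : fderiv ℝ ((f : E → F) + (g : E → F)) = fderiv ℝ (f : E → F) + fderiv ℝ (g : E → F) :=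
      funext fun x => fderiv_add (f.differentiable x) (g.differentiable x)
    rw [h]
    exact f.memBoundedHolder.add g.memBoundedHolder⟩⟩

/-- Pointwise negation. [folklore] -/
instance instNeg : Neg (C1HolderMap E F r) :=
  ⟨fun f => ⟨-⇑f, f.contDiff.neg, by
    have h : fderiv ℝ (-(f : E → F)) = -fderiv ℝ (f : E → F) := funext fun x => fderiv_neg
    rw [h]
    exact f.memBoundedHolder.neg⟩⟩

/-- Pointwise subtraction. [folklore] -/
instance instSub : Sub (C1HolderMap E F r) :=
  ⟨fun f g => ⟨⇑f - ⇑g, f.contDiff.sub g.contDiff, by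
    have h : fderiv ℝ ((f : E → F) - (g : E → F)) = fderiv ℝ (f : E → F) - fderiv ℝ (g : E → F) :=
      funext fun x => fderiv_sub (f.differentiable x) (g.differentiable x)
    rw [h]
    exact f.memBoundedHolder.sub g.memBoundedHolder⟩⟩

/-- Real scalar multiplication. [folklore] -/
instance instSMul : SMul ℝ (C1HolderMap E F r) :=
  ⟨fun c f => ⟨c • ⇑f, f.contDiff.const_smul c, by
    have h : fderiv ℝ (c • (f : E → F)) = c • fderiv ℝ (f : E → F) :=
      funext fun x => fderiv_const_smul (f.differentiable x) c
    rw [h]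
    exact f.memBoundedHolder.smul c⟩⟩

/-- Natural scalar multiplication (through the real one). [folklore] -/
instance instNSMul : SMul ℕ (C1HolderMap E F r) :=
  ⟨fun n f => (n : ℝ) • f⟩

/-- Integer scalar multiplication (through the real one). [folklore] -/
instance instZSMul : SMul ℤ (C1HolderMap E F r) :=
  ⟨fun n f => (n : ℝ) • f⟩

/-- The zero element is the zero function. [folklore] -/
@[simp] theorem coe_zero : ((0 : C1HolderMap E F r) : E → F) = 0 := rfl

/-- Addition is pointwise. [folklore] -/
@[simp] theorem coe_add (f g : C1HolderMap E F r) : ⇑(f + g) = f + g := rfl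

/-- Negation is pointwise. [folklore] -/
@[simp] theorem coe_neg (f : C1HolderMap E F r) : ⇑(-f) = -f := rfl

/-- Subtraction is pointwise. [folklore] -/
@[simp] theorem coe_sub (f g : C1HolderMap E F r) : ⇑(f - g) = f - g := rfl

/-- Real scalar multiplication is pointwise. [folklore] -/
@[simp] theorem coe_smul (c : ℝ) (f : C1HolderMap E F r) : ⇑(c • f) = c • f := rfl

/-- Natural scalar multiplication is pointwise. [folklore] -/
theorem coe_nsmul (n : ℕ) (f : C1HolderMap E F r) : ⇑(n • f) = n • (f : E → F) := by
  show ((n : ℝ) • f : E → F) = n • (f : E → F)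
  funext x
  simp [Nat.cast_smul_eq_nsmul]

/-- Integer scalar multiplication is pointwise. [folklore] -/
theorem coe_zsmul (n : ℤ) (f : C1HolderMap E F r) : ⇑(n • f) = n • (f : E → F) := by
  show ((n : ℝ) • f : E → F) = n • (f : E → F)
  funext x
  simp [Int.cast_smul_eq_zsmul]

/-- `C1HolderMap E F r` is an additive commutative group (pulled back from `E → F`). [folklore] -/
instance instAddCommGroup : AddCommGroup (C1HolderMap E F r) :=
  DFunLike.coe_injective.addCommGroup _ coe_zero coe_add coe_neg coe_sub (fun f n => coe_nsmul n f)
    (fun f n => coe_zsmul n f)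

/-- The coercion to functions as an additive monoid homomorphism. [folklore] -/
def coeAddHom : C1HolderMap E F r →+ (E → F) where
  toFun := (⇑)
  map_zero' := coe_zero
  map_add' := coe_add

/-- `C1HolderMap E F r` is a real vector space (pulled back from `E → F`). [folklore] -/
instance instModule : Module ℝ (C1HolderMap E F r) :=
  DFunLike.coe_injective.module ℝ coeAddHom coe_smul

/-- `fderivBHF` is additive. [folklore] -/
theorem fderivBHF_add (f g : C1HolderMap E F r) : (f + g).fderivBHF = f.fderivBHF + g.fderivBHF :=
  BoundedHolderFunction.ext fun x => fderiv_add (f.differentiable x) (g.differentiable x)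

/-- `fderivBHF` commutes with negation. [folklore] -/
theorem fderivBHF_neg (f : C1HolderMap E F r) : (-f).fderivBHF = -f.fderivBHF :=
  BoundedHolderFunction.ext fun _ => fderiv_neg

/-- `fderivBHF` commutes with subtraction. [folklore] -/
theorem fderivBHF_sub (f g : C1HolderMap E F r) : (f - g).fderivBHF = f.fderivBHF - g.fderivBHF :=
  BoundedHolderFunction.ext fun x => fderiv_sub (f.differentiable x) (g.differentiable x)

/-- `fderivBHF` is real-homogeneous. [folklore] -/
theorem fderivBHF_smul (c : ℝ) (f : C1HolderMap E F r) : (c • f).fderivBHF = c • f.fderivBHF :=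
  BoundedHolderFunction.ext fun x => fderiv_const_smul (f.differentiable x) c

/-- `fderivBHF 0 = 0`. [folklore] -/
@[simp]
theorem fderivBHF_zero : (0 : C1HolderMap E F r).fderivBHF = 0 :=
  BoundedHolderFunction.ext fun _ => fderiv_const_apply 0

/-! ### The norm `|X|_{1,r} = ‖X 0‖ + ‖∇X‖_∞ + [∇X]_r` -/

/-- **Majda–Bertozzi's norm (4.13)**: `‖X‖ = ‖X 0‖ + ‖fderivBHF X‖`, where the second term is the
inhomogeneous Hölder norm `‖∇X‖_∞ + [∇X]_r` of `HolderSpace.lean`. [cite: MajdaBertozziCUP2002, §4.1.1 (4.13) (p. 126)] -/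
instance instNorm : Norm (C1HolderMap E F r) :=
  ⟨fun f => ‖f 0‖ + ‖f.fderivBHF‖⟩

/-- Unfolding the norm. [folklore] -/
theorem norm_def (f : C1HolderMap E F r) : ‖f‖ = ‖f 0‖ + ‖f.fderivBHF‖ := rfl

/-- The value at the origin is bounded by the norm. [folklore] -/
theorem norm_apply_zero_le (f : C1HolderMap E F r) : ‖f 0‖ ≤ ‖f‖ :=
  le_add_of_nonneg_right (norm_nonneg _)

/-- The Hölder norm of the derivative is bounded by the norm. [folklore] -/
theorem norm_fderivBHF_le (f : C1HolderMap E F r) : ‖f.fderivBHF‖ ≤ ‖f‖ :=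
  le_add_of_nonneg_left (norm_nonneg _)

/-- The derivative at every point is bounded by the norm (`‖∇X(x)‖ ≤ |∇X|₀ ≤ |X|_{1,r}`). [folklore] -/
theorem norm_fderiv_le (f : C1HolderMap E F r) (x : E) : ‖fderiv ℝ (f : E → F) x‖ ≤ ‖f‖ :=
  (f.fderivBHF.norm_apply_le_norm x).trans f.norm_fderivBHF_le

/-- **Lipschitz bound**: `‖X x − X y‖ ≤ |X|_{1,r} ‖x − y‖` (mean value inequality with
`‖∇X‖ ≤ |X|_{1,r}`). [folklore] -/
theorem norm_sub_apply_le (f : C1HolderMap E F r) (x y : E) : ‖f x - f y‖ ≤ ‖f‖ * ‖x - y‖ :=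
  (convex_univ).norm_image_sub_le_of_norm_fderiv_le (fun z _ => f.differentiable z)
    (fun z _ => f.norm_fderiv_le z) (mem_univ y) (mem_univ x)

/-- **Growth bound**: `‖X x‖ ≤ |X|_{1,r} (1 + ‖x‖)` — elements may be unbounded, but grow at most
linearly (Majda–Bertozzi, p. 126). [folklore] -/
theorem norm_apply_le (f : C1HolderMap E F r) (x : E) : ‖f x‖ ≤ ‖f‖ * (1 + ‖x‖) := by
  have h1 : ‖f x - f 0‖ ≤ ‖f‖ * ‖x‖ := by simpa using f.norm_sub_apply_le x 0
  have hn : 0 ≤ ‖f‖ := add_nonneg (norm_nonneg _) (norm_nonneg _)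
  calc ‖f x‖ = ‖(f x - f 0) + f 0‖ := by rw [sub_add_cancel]
    _ ≤ ‖f x - f 0‖ + ‖f 0‖ := norm_add_le _ _
    _ ≤ ‖f‖ * ‖x‖ + ‖f‖ := add_le_add h1 f.norm_apply_zero_le
    _ = ‖f‖ * (1 + ‖x‖) := by ring

/-- The norm of `-f` is that of `f`. [folklore] -/
theorem norm_neg' (f : C1HolderMap E F r) : ‖-f‖ = ‖f‖ := by
  rw [norm_def, norm_def, fderivBHF_neg, norm_neg, coe_neg, Pi.neg_apply, norm_neg]

/-- Triangle inequality. [folklore] -/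
theorem norm_add_le' (f g : C1HolderMap E F r) : ‖f + g‖ ≤ ‖f‖ + ‖g‖ := by
  rw [norm_def, norm_def, norm_def, fderivBHF_add, coe_add, Pi.add_apply]
  have h₁ := norm_add_le (f 0) (g 0)
  have h₂ := norm_add_le f.fderivBHF g.fderivBHF
  linarith

/-- **Definiteness**: only `0` has norm `0` (zero derivative makes the map constant, Mathlib
`is_const_of_fderiv_eq_zero`, and the constant is the value `0` at the origin). [folklore] -/
theorem eq_zero_of_norm_eq_zero {f : C1HolderMap E F r} (h : ‖f‖ = 0) : f = 0 := by
  rw [norm_def] at h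
  have h0 : ‖f 0‖ = 0 := le_antisymm (by linarith [norm_nonneg f.fderivBHF]) (norm_nonneg _)
  have h1 : ‖f.fderivBHF‖ = 0 := le_antisymm (by linarith [norm_nonneg (f 0)]) (norm_nonneg _)
  have hD : ∀ x, fderiv ℝ (f : E → F) x = 0 := fun x => by
    have := congrArg (fun g : BoundedHolderFunction E (E →L[ℝ] F) r => g x) (norm_eq_zero.1 h1)
    simpa using this
  ext x
  rw [coe_zero, Pi.zero_apply, is_const_of_fderiv_eq_zero f.differentiable hD x 0]
  exact norm_eq_zero.1 h0

/-- The norm as an `AddGroupNorm`. [folklore] -/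
def addGroupNorm : AddGroupNorm (C1HolderMap E F r) where
  toFun f := ‖f‖
  map_zero' := by simp [norm_def]
  add_le' := norm_add_le'
  neg' := norm_neg'
  eq_zero_of_map_eq_zero' _ := eq_zero_of_norm_eq_zero

/-- `C1HolderMap E F r` is a normed additive commutative group for `|·|_{1,r}`
(Majda–Bertozzi, p. 126: "`B` … is linear, normed"). [folklore] -/
instance instNormedAddCommGroup : NormedAddCommGroup (C1HolderMap E F r) :=
  { AddGroupNorm.toNormedAddCommGroup addGroupNorm with
    norm := fun f => ‖f‖
    dist := fun f g => ‖-f + g‖ }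

/-- Homogeneity of the norm. [folklore] -/
theorem norm_smul' (c : ℝ) (f : C1HolderMap E F r) : ‖c • f‖ = ‖c‖ * ‖f‖ := by
  rw [norm_def, norm_def, fderivBHF_smul, norm_smul, coe_smul, Pi.smul_apply, norm_smul, mul_add]

/-- `C1HolderMap E F r` is a real normed space. [folklore] -/
instance instNormedSpace : NormedSpace ℝ (C1HolderMap E F r) where
  norm_smul_le c f := (norm_smul' c f).le

/-- **The derivative as a continuous linear map** `C1HolderMap E F r →L[ℝ] C^{0,r}_b(E, E →L F)`
(norm `≤ 1`). [folklore] -/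
def fderivCLM : C1HolderMap E F r →L[ℝ] BoundedHolderFunction E (E →L[ℝ] F) r :=
  LinearMap.mkContinuous
    { toFun := fderivBHF
      map_add' := fderivBHF_add
      map_smul' := fderivBHF_smul } 1
    fun f => by simpa using f.norm_fderivBHF_le

/-- `fderivCLM f = fderivBHF f`. [folklore] -/
@[simp]
theorem fderivCLM_apply (f : C1HolderMap E F r) : fderivCLM f = f.fderivBHF := rfl

/-- **Evaluation at a point as a continuous linear map** (bound `1 + ‖x‖`, `norm_apply_le`). [folklore] -/
def evalCLM (x : E) : C1HolderMap E F r →L[ℝ] F :=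
  LinearMap.mkContinuous
    { toFun := fun f => f x
      map_add' := fun f g => rfl
      map_smul' := fun c f => rfl } (1 + ‖x‖)
    fun f => by
      rw [mul_comm]
      exact f.norm_apply_le x

/-- `evalCLM x f = f x`. [folklore] -/
@[simp]
theorem evalCLM_apply (x : E) (f : C1HolderMap E F r) : evalCLM x f = f x := rfl

/-! ### Completeness -/

/-- **`C1HolderMap E F r` is a Banach space for complete `F`** (Majda–Bertozzi, p. 126: "The space
`B` in Eq. (4.12) is a Banach space; it is linear, normed, and complete"). Proof: along a Cauchy
sequence `u`, the derivatives `fderivBHF (u n)` are Cauchy in the Banach space `C^{0,r}_b`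
(`BoundedHolderFunction.completeSpace_holds`), hence converge to some `D`, uniformly in
particular; the values `u n x` are Cauchy for every `x` (`evalCLM`), hence converge to some
`g x`; by Mathlib's `hasFDerivAt_of_tendstoUniformly`, `g` is differentiable with `fderiv g = D`,
so `g` defines an element `G` with `fderivBHF G = D`, and
`‖u n − G‖ = ‖u n 0 − g 0‖ + ‖fderivBHF (u n) − D‖ → 0`. [cite: MajdaBertozziCUP2002, §4.1.1 (p. 126, B is a Banach space)] -/
instance instCompleteSpace [CompleteSpace F] : CompleteSpace (C1HolderMap E F r) := by
  haveI : CompleteSpace (BoundedHolderFunction E (E →L[ℝ] F) r) :=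
    BoundedHolderFunction.completeSpace_holds
  refine Metric.complete_of_cauchySeq_tendsto fun u hu => ?_
  -- derivatives converge in `C^{0,r}_b`
  have hDc : CauchySeq fun n => (u n).fderivBHF :=
    (fderivCLM (E := E) (F := F) (r := r)).uniformContinuous.comp_cauchySeq hu
  obtain ⟨D, hD⟩ := cauchySeq_tendsto_of_complete hDc
  -- values converge at every point
  have hpc : ∀ x, CauchySeq fun n => u n x := fun x =>
    (evalCLM (E := E) (F := F) (r := r) x).uniformContinuous.comp_cauchySeq hu
  choose g hg using fun x => cauchySeq_tendsto_of_complete (hpc x)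
  -- the derivatives converge uniformly to `D`
  have hunif : TendstoUniformly (fun n => fderiv ℝ (u n : E → F)) (D : E → E →L[ℝ] F) atTop := by
    have h1 : Tendsto (fun n => (u n).fderivBHF.toBoundedContinuousFunction) atTop
        (𝓝 D.toBoundedContinuousFunction) :=
      ((BoundedHolderFunction.toBoundedContinuousFunctionCLM (X := E) (Y := E →L[ℝ] F)
        (r := r)).continuous.tendsto D).comp hD
    rw [BoundedContinuousFunction.tendsto_iff_tendstoUniformly] at h1
    exact h1
  -- hence `g` is differentiable with derivative `D`
  have hderiv : ∀ x, HasFDerivAt g (D x) x :=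
    hasFDerivAt_of_tendstoUniformly hunif
      (fun n x => ((u n).differentiable x).hasFDerivAt) hg
  have hfd : fderiv ℝ g = (D : E → E →L[ℝ] F) := funext fun x => (hderiv x).fderiv
  have hgdiff : Differentiable ℝ g := fun x => (hderiv x).differentiableAt
  have hg1 : ContDiff ℝ 1 g := by
    rw [contDiff_one_iff_fderiv, hfd]
    exact ⟨hgdiff, D.continuous⟩
  have hgH : MemBoundedHolder r (fderiv ℝ g) := by
    rw [hfd]
    exact D.memBoundedHolder
  set G : C1HolderMap E F r := ⟨g, hg1, hgH⟩ with hG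
  have hGD : G.fderivBHF = D := BoundedHolderFunction.ext fun x => (hderiv x).fderiv
  refine ⟨G, ?_⟩
  -- convergence in the norm: both components tend to `0`
  have h0 : Tendsto (fun n => ‖u n 0 - G 0‖) atTop (𝓝 0) := by
    have := (tendsto_iff_norm_sub_tendsto_zero.1 (hg 0))
    exact this
  have h1 : Tendsto (fun n => ‖(u n).fderivBHF - G.fderivBHF‖) atTop (𝓝 0) := by
    rw [hGD]
    exact tendsto_iff_norm_sub_tendsto_zero.1 hD
  rw [tendsto_iff_norm_sub_tendsto_zero]
  have hsum := h0.add h1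
  rw [add_zero] at hsum
  refine hsum.congr fun n => ?_
  rw [norm_def, coe_sub, Pi.sub_apply, fderivBHF_sub]

end C1HolderMap

/-- **The bounded class `C^{1,r}_b` embeds in `B`**: a function in `MemContDiffHolder 1 r`
(`HolderNorm.lean`: `C¹`, `f` and `Df` bounded, `Df` `r`-Hölder) defines an element of
`C1HolderMap E F r` (the derivative `fderiv` is the `1`-st iterated derivative up to the
isometry `continuousMultilinearCurryFin1`). [folklore] -/
def MemContDiffHolder.toC1HolderMap {E F : Type*} [NormedAddCommGroup E] [NormedSpace ℝ E]
    [NormedAddCommGroup F] [NormedSpace ℝ F] {r : ℝ≥0} {f : E → F}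
    (hf : MemContDiffHolder 1 r f) : C1HolderMap E F r where
  toFun := f
  contDiff' := hf.contDiff
  memBoundedHolder' := by
    -- `fderiv ℝ f = (curryFin1).symm ∘ iteratedFDeriv ℝ 1 f`, an isometric image
    have hrepr : fderiv ℝ f =
        fun x => (continuousMultilinearCurryFin1 ℝ E F) (iteratedFDeriv ℝ 1 f x) := by
      funext x
      ext v
      rw [continuousMultilinearCurryFin1_apply, iteratedFDeriv_one_apply]
      rfl
    refine memBoundedHolder_iff.2 ⟨?_, ?_⟩
    · obtain ⟨C, hC⟩ := eSupNorm_lt_top_iff.1 (hf.2.1 1 le_rfl)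
      refine ⟨C, fun x => ?_⟩
      rw [← norm_iteratedFDeriv_one (𝕜 := ℝ)]
      · exact hC x
    · obtain ⟨C, hC⟩ := hf.2.2
      refine ⟨C, fun x y => ?_⟩
      rw [hrepr]
      simp only [LinearIsometryEquiv.edist_map]
      exact hC x y

/-- The underlying map of `MemContDiffHolder.toC1HolderMap` is the function itself. [folklore] -/
@[simp]
theorem MemContDiffHolder.coe_toC1HolderMap {E F : Type*} [NormedAddCommGroup E]
    [NormedSpace ℝ E] [NormedAddCommGroup F] [NormedSpace ℝ F] {r : ℝ≥0} {f : E → F}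
    (hf : MemContDiffHolder 1 r f) : (hf.toC1HolderMap : E → F) = f := rfl

end Literature.Analysis.FunctionSpaces
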